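import Mathlib
import Summits.NavierStokesRegularity.NavierStokesRegularity.Theses.SymmetryModuliCount
import Literature.Analysis.FluidPDE.TypeIAncientMild
import Literature.Analysis.FluidPDE.OseenSlice
import HarnessLib

/-! drefute g2 work file: verbatim stub signatures of skeleton d4c7fc4e (7 stubs) + probes +
joint-sufficiency composition (stubs ⇒ crux by name). -/

noncomputable section

open Set MeasureTheory Function Filter
open Literature.Analysis.FluidPDE
open Literature.Analysis.UnboundedOperators (heatExtension)
open scoped RealInnerProductSpace Topology

namespace Summit.NavierStokesRegularity.NavierStokesRegularity.Cruxes.HelicalEndLiouville.Lines.DrefuteG2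

local notation "E3" => EuclideanSpace ℝ (Fin 3)

def S1_helicalScrewPeriod : Prop :=
  ∀ (a : E3) (A : E3 →L[ℝ] E3), (∀ x, inner ℝ (A x) x = 0) → a ∉ Set.range A → ∃ L : E3, L ≠ 0 ∧ ∀ (f : E3 → E3), Differentiable ℝ f → (∀ x, fderiv ℝ f x (a + A x) - A (f x) = 0) → ∀ x, f (x + L) = f x

def S2_cellGaps : Prop :=
  ∃ κ : ℝ, 0 < κ ∧ (∀ (L : E3) (g : E3 → E3) (M σ : ℝ), Continuous g → (∀ x, g (x + L) = g x) → (∀ x, ‖g x‖ ≤ M) → 0 < σ → ∀ x : E3, ‖heatExtension g σ x - ∫ r in (0:ℝ)..1, heatExtension g σ (x + r • L)‖ ≤ κ * (‖L‖ ^ 2 / σ) * M) ∧ (∀ (L : E3) (f g : E3 → E3) (Mf Mg σ : ℝ), Continuous f → Continuous g → (∀ x, f (x + L) = f x) → (∀ x, g (x + L) = g x) → (∀ x, ‖f x‖ ≤ Mf) → (∀ x, ‖g x‖ ≤ Mg) → 0 < σ → ∀ x : E3, ‖oseenSlice σ f g x - ∫ r in (0:ℝ)..1, oseenSlice σ f g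 (x + r • L)‖ ≤ κ * min (σ ^ (-(1 / 2 : ℝ))) (‖L‖ ^ 2 * σ ^ (-(3 / 2 : ℝ))) * Mf * Mg)

def S3_cellOscRepr : Prop :=
  ∀ (C : ℝ) (u : ℝ → E3 → E3), IsTypeIAncientMild C u → ∀ (L : E3) (s t : ℝ), s < t → t < 0 → ∀ x : E3, u t x - (∫ r in (0:ℝ)..1, u t (x + r • L)) = (heatExtension (u s) (t - s) x - ∫ r in (0:ℝ)..1, heatExtension (u s) (t - s) (x + r • L)) - ∫ τ in Set.Ioo s t, (oseenSlice (t - τ) (u τ) (u τ) x - ∫ r in (0:ℝ)..1, oseenSlice (t - τ) (u τ) (u τ) (x + r • L))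

def S4_cellOscSlice : Prop :=
  ∀ κ : ℝ, (∀ (L : E3) (f g : E3 → E3) (Mf Mg σ : ℝ), Continuous f → Continuous g → (∀ x, f (x + L) = f x) → (∀ x, g (x + L) = g x) → (∀ x, ‖f x‖ ≤ Mf) → (∀ x, ‖g x‖ ≤ Mg) → 0 < σ → ∀ x : E3, ‖oseenSlice σ f g x - ∫ r in (0:ℝ)..1, oseenSlice σ f g (x + r • L)‖ ≤ κ * min (σ ^ (-(1 / 2 : ℝ))) (‖L‖ ^ 2 * σ ^ (-(3 / 2 : ℝ))) * Mf * Mg) → ∃ K : ℝ, 0 < K ∧ ∀ (L : E3) (f : E3 → E3) (M S σ : ℝ), Continuous f → (∀ x, f (x + L) = f x) → (∀ x, ‖f x‖ ≤ M) → (∀ x, ‖f x - ∫ r in (0:ℝ)..1, f (x + r • L)‖ ≤ S) → 0 < σ → ∀ x : E3, ‖oseenSlice σ f f x - ∫ r in (0:ℝ)..1, oseenSlice σ f f (x + r • L)‖ ≤ K * min (σ ^ (-(1 / 2 : ℝ))) (‖L‖ ^ 2 * σ ^ (-(3 / 2 : ℝ))) * M * S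

def S5_cellAbsorption : Prop :=
  ∀ κ K : ℝ, (∀ (L : E3) (g : E3 → E3) (M σ : ℝ), Continuous g → (∀ x, g (x + L) = g x) → (∀ x, ‖g x‖ ≤ M) → 0 < σ → ∀ x : E3, ‖heatExtension g σ x - ∫ r in (0:ℝ)..1, heatExtension g σ (x + r • L)‖ ≤ κ * (‖L‖ ^ 2 / σ) * M) → (∀ (C : ℝ) (u : ℝ → E3 → E3), IsTypeIAncientMild C u → ∀ (L : E3) (s t : ℝ), s < t → t < 0 → ∀ x : E3, u t x - (∫ r in (0:ℝ)..1, u t (x + r • L)) = (heatExtension (u s) (t - s) x - ∫ r in (0:ℝ)..1, heatExtension (u s) (t - s) (x + r • L)) - ∫ τ in Set.Ioo s t, (oseenSlice (t - τ) (u τ) (u τ) x - ∫ r in (0:ℝ)..1, oseenSlice (t - τ) (u τ) (u τ) (x + r • L))) → (∀ (L : E3) (f : E3 → E3) (M S σ : ℝ), Continuous f → (∀ x, f (x + L) = f x) → (∀ x, ‖f x‖ ≤ M) → (∀ x, ‖f x - ∫ r in (0:ℝ)..1, f (x + r • L)‖ ≤ S) → 0 < σ → ∀ x : E3, ‖oseenSlice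 σ f f x - ∫ r in (0:ℝ)..1, oseenSlice σ f f (x + r • L)‖ ≤ K * min (σ ^ (-(1 / 2 : ℝ))) (‖L‖ ^ 2 * σ ^ (-(3 / 2 : ℝ))) * M * S) → ∀ (C : ℝ) (u : ℝ → E3 → E3), IsTypeIAncientMild C u → ∀ (L : E3) (θ : ℝ), L ≠ 0 → θ ≤ 0 → (∀ t < θ, ∀ x, u t (x + L) = u t x) → ∀ t < θ, t < -(8 * K * C * ‖L‖) ^ 2 → ∀ (x : E3) (s : ℝ), u t (x + s • L) = u t x

def S6_lineLiouvilleEnd : Prop :=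
  ∀ (C : ℝ) (u : ℝ → E3 → E3), IsTypeIAncientMild C u → ∀ (L : E3) (T : ℝ), L ≠ 0 → T ≤ 0 → (∀ t < T, ∀ (x : E3) (s : ℝ), u t (x + s • L) = u t x) → ∀ t < T, ∀ x, u t x = 0

def S7_forwardVanishing : Prop :=
  ∀ (C : ℝ) (u : ℝ → E3 → E3), IsTypeIAncientMild C u → ∀ θ : ℝ, θ ≤ 0 → (∀ t < θ, ∀ x, u t x = 0) → ∀ t < 0, ∀ x, u t x = 0

theorem probe_crux : Summit.NavierStokesRegularity.NavierStokesRegularity.Theses.SymmetryModuliCount.HelicalEndLiouville := by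
  sorry

/-- Slices of a Type-I ancient mild field are differentiable (from joint smoothness). -/
theorem differentiable_slice {C : ℝ} {u : ℝ → E3 → E3} (hu : IsTypeIAncientMild C u) {t : ℝ}
    (ht : t < 0) : Differentiable ℝ (u t) := by
  have hcd := hu.contDiffOn
  intro x
  have hmem : (t, x) ∈ Iio (0:ℝ) ×ˢ (univ : Set E3) := ⟨ht, mem_univ _⟩
  have hopen : IsOpen (Iio (0:ℝ) ×ˢ (univ : Set E3)) := isOpen_Iio.prod isOpen_univ
  have h1 : ContDiffAt ℝ (⊤ : ℕ∞) (uncurry u) (t, x) := (hcd (t, x) hmem).contDiffAt (hopen.mem_nhds hmem)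
  have h2 : DifferentiableAt ℝ (uncurry u) (t, x) := h1.differentiableAt (by simp)
  have h3 : DifferentiableAt ℝ (fun y : E3 => (t, y)) x := by fun_prop
  have := h2.comp x h3
  simpa [Function.comp_def, uncurry] using this

/-- JOINT SUFFICIENCY: the seven verbatim stubs give the crux by name. -/
theorem crux_of_stubs (h1 : S1_helicalScrewPeriod) (h2 : S2_cellGaps) (h3 : S3_cellOscRepr)
    (h4 : S4_cellOscSlice) (h5 : S5_cellAbsorption) (h6 : S6_lineLiouvilleEnd)
    (h7 : S7_forwardVanishing) :
    Summit.NavierStokesRegularity.NavierStokesRegularity.Theses.SymmetryModuliCount.HelicalEndLiouville := by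
  intro C u hu a A θ hA ha hθ hsym t ht x
  obtain ⟨L, hL0, hL⟩ := h1 a A hA ha
  -- periodicity on the end
  have hper : ∀ t < θ, ∀ x, u t (x + L) = u t x := fun t' ht' y =>
    hL (u t') (differentiable_slice hu (lt_of_lt_of_le ht' hθ)) (hsym t' ht') y
  obtain ⟨κ, hκ, hheat, hoseen⟩ := h2
  obtain ⟨K, hK, hslice⟩ := h4 κ hoseen
  have hflat := h5 κ K hheat h3 hslice C u hu L θ hL0 hθ hper
  -- far end: T := min θ (-(8*K*C*‖L‖)^2 - 1)
  set T : ℝ := min θ (-(8 * K * C * ‖L‖) ^ 2 - 1) with hT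
  have hTθ : T ≤ θ := min_le_left _ _
  have hT0 : T ≤ 0 := hTθ.trans hθ
  have hline : ∀ t < T, ∀ (x : E3) (s : ℝ), u t (x + s • L) = u t x := by
    intro t' ht' y s
    have h1' : t' < θ := lt_of_lt_of_le ht' hTθ
    have h2' : t' < -(8 * K * C * ‖L‖) ^ 2 := by
      have : T ≤ -(8 * K * C * ‖L‖) ^ 2 - 1 := min_le_right _ _
      linarith
    exact hflat t' h1' h2' y s
  have hzero : ∀ t < T, ∀ x, u t x = 0 := h6 C u hu L T hL0 hT0 hline
  exact h7 C u hu T hT0 hzero t (lt_of_lt_of_le ht hθ) x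

end Summit.NavierStokesRegularity.NavierStokesRegularity.Cruxes.HelicalEndLiouville.Lines.DrefuteG2
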